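import Summits.AnomalousDissipation.AnomalousDissipation.Theses.WazewskiBlock
import Summits.AnomalousDissipation.AnomalousDissipation.Theorems.MomentParityFamilyOfOrbits
import Literature.Analysis.FluidPDE.NSGalerkinFamilyWeakForm
import Literature.Analysis.FluidPDE.SteadyNavierStokesLimit

/-!
# Route WazewskiBlock · `GalerkinTrapToLerayHopf` (stmt-AnomalousDissipation-10355)

A family of global Galerkin trajectories of orders `N ≥ N₀` of the Navier–Stokes system on `𝕋³`
with viscosity `ν > 0` and a steady trigonometric-polynomial force `f`, each trapped for all
`t ≥ 0` in the block `{kineticEnergy ≤ E} ∩ {(f, ·) ≥ ε₀} ∩ {eGradNormSq ≤ G}`, has a global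
Leray–Hopf limit satisfying the same three pointwise-in-time bounds.

Proof (Hopf's compactness argument, Robinson–Rodrigo–Sadowski 2016, Thm. 4.4 Steps 3–4,
Thm. 4.6, Cor. 4.7, Thm. 4.11; Constantin–Foias 1988, Ch. 8), entirely by re-plumbing the tree's
Hopf–Galerkin *family* pipeline (`NSGalerkinFamilyLimit`, `NSGalerkinFamilyEnergy`,
`NSGalerkinFamilyWeakForm`):

* the trapped trajectories `U n` (order `n + N₀`, steady force `F n = f`, reference datum the
  constant field of energy `2E`) form an `IsHopfGalerkinFamily` — the energy cap gives the datum
  bound `∫ ‖U n 0‖² ≤ 2E`;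
* `IsHopfGalerkinFamily.exists_limitField` extracts a subsequence converging coefficientwise at
  every `t ≥ 0` to a field `u` with `L²` slices;
* the enstrophy cap at `t = 0` upgrades the convergence of the data to strong `L²` convergence
  (`tendsto_lintegral_enorm_sub_sq_of_tendsto_mFourierCoeff`, Rellich on the torus, with Fatou
  `eGradNormSq_le_liminf_of_tendsto_mFourierCoeff` for the limit), so
  `IsHopfGalerkinFamily.isGlobalLerayHopf_limit` applies: `u` is a global Leray–Hopf solution from
  `u 0`;
* the faces pass to the limit pointwise in `t`: the energy cap by Parseval and lower
  semicontinuity of finite sums, the work floor by the weak `L²` convergence at every time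
  (`IsHopfGalerkinFamily.tendsto_integral_inner_limit`), the enstrophy cap by Fatou.
-/

noncomputable section

open MeasureTheory Set Filter Topology Function UnitAddTorus
open scoped InnerProductSpace RealInnerProductSpace ENNReal NNReal

namespace Summit.AnomalousDissipation.AnomalousDissipation.Theorems

-- the summit namespace `Summit.AnomalousDissipation.AnomalousDissipation` (single-conjunct summit,
-- D-0017) repeats the problem name by design
set_option linter.dupNamespace false

open Literature.Analysis.FunctionSpaces Literature.Analysis.FunctionSpaces.Torus
open Literature.Analysis.FluidPDE Literature.Analysis.FluidPDE.Torus

/-- **Lower semicontinuity of the energy under coefficientwise convergence** (Parseval on finite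
frequency sets): if `𝓕(v n)(k) → 𝓕(w)(k)` for every `k` and `∫ ‖v n‖² ≤ Y` for all `n`, then
`∫ ‖w‖² ≤ Y` (`v n, w ∈ L²(𝕋³; ℝ³)`). -/
theorem integral_norm_sq_le_of_tendsto_mFourierCoeff
    {v : ℕ → UnitAddTorus (Fin 3) → EuclideanSpace ℝ (Fin 3)}
    {w : UnitAddTorus (Fin 3) → EuclideanSpace ℝ (Fin 3)} (hv : ∀ n, MemLp (v n) 2 volume)
    (hw : MemLp w 2 volume) {Y : ℝ} (hY : ∀ n, ∫ x, ‖v n x‖ ^ 2 ≤ Y)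
    (hc : ∀ k, Tendsto (fun n => mFourierCoeff (EuclideanSpace.complexify ∘ v n) k) atTop
      (𝓝 (mFourierCoeff (EuclideanSpace.complexify ∘ w) k))) :
    ∫ x, ‖w x‖ ^ 2 ≤ Y := by
  refine hasSum_le_of_sum_le (hasSum_sq_norm_mFourierCoeff_complexify hw) fun S => ?_
  have hlim : Tendsto (fun n => ∑ k ∈ S, ‖mFourierCoeff (EuclideanSpace.complexify ∘ v n) k‖ ^ 2)
      atTop (𝓝 (∑ k ∈ S, ‖mFourierCoeff (EuclideanSpace.complexify ∘ w) k‖ ^ 2)) :=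
    tendsto_finsetSum _ fun k _ => ((hc k).norm).pow 2
  refine le_of_tendsto' hlim fun n => ?_
  exact (sum_le_hasSum S (fun k _ => sq_nonneg _)
    (hasSum_sq_norm_mFourierCoeff_complexify (hv n))).trans (hY n)

/-- **Strong `L²` convergence of trapped Galerkin data** (Rellich on `𝕋³`, sequential form): if
`𝓕(v n)(k) → 𝓕(w)(k)` for every `k`, `‖∇(v n)‖² ≤ G` for all `n` (`v n, w ∈ L²`), then
`‖v n - w‖_{L²} → 0`; the bound `‖∇w‖² ≤ G` needed by
`tendsto_lintegral_enorm_sub_sq_of_tendsto_mFourierCoeff` is Fatou's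
(`eGradNormSq_le_liminf_of_tendsto_mFourierCoeff`). -/
theorem tendsto_eLpNorm_sub_of_tendsto_mFourierCoeff_of_eGradNormSq_le
    {v : ℕ → UnitAddTorus (Fin 3) → EuclideanSpace ℝ (Fin 3)}
    {w : UnitAddTorus (Fin 3) → EuclideanSpace ℝ (Fin 3)} (hv : ∀ n, MemLp (v n) 2 volume)
    (hw : MemLp w 2 volume) {G : ℝ≥0} (hG : ∀ n, eGradNormSq (v n) ≤ (G : ℝ≥0∞))
    (hc : ∀ k, Tendsto (fun n => mFourierCoeff (EuclideanSpace.complexify ∘ v n) k) atTop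
      (𝓝 (mFourierCoeff (EuclideanSpace.complexify ∘ w) k))) :
    Tendsto (fun n => eLpNorm (v n - w) 2 volume) atTop (𝓝 0) := by
  -- Fatou for the limit (the time variable of the tree lemma is a dummy here)
  have hgw : eGradNormSq w ≤ (G : ℝ≥0∞) := by
    have h := eGradNormSq_le_liminf_of_tendsto_mFourierCoeff (U := fun n (_ : ℝ) => v n)
      (u := fun _ => w) (fun _ _ k => hc k) (t := 0) le_rfl
    refine h.trans ?_
    exact liminf_le_of_frequently_le' (Eventually.of_forall fun n => hG n).frequently
  have hZ := tendsto_lintegral_enorm_sub_sq_of_tendsto_mFourierCoeff hv hw ENNReal.coe_ne_top hG hgw hc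
  have h := ((ENNReal.continuous_rpow_const (y := 1 / 2)).tendsto 0).comp hZ
  rw [ENNReal.zero_rpow_of_pos (by norm_num)] at h
  refine h.congr fun n => ?_
  simp only [Function.comp_apply, Literature.Analysis.FluidPDE.Torus.eLpNorm_two_eq_rpow, Pi.sub_apply]

/-- **`GalerkinTrapToLerayHopf`** (route WazewskiBlock, stmt-AnomalousDissipation-10355): for
`ν > 0`, a mean-zero trigonometric-polynomial force `f`, and constants `E`, `ε₀`, `G`, if for every
order `N ≥ N₀` some global Galerkin trajectory of order `N` driven by `f` stays for all `t ≥ 0` in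
`{kineticEnergy ≤ E} ∩ {(f, ·) ≥ ε₀} ∩ {eGradNormSq ≤ G}`, then a global Leray–Hopf solution of the
Navier–Stokes equations with force `f` satisfies the same three bounds for all `t ≥ 0`
(Hopf's Galerkin limit, Robinson–Rodrigo–Sadowski 2016, Thm. 4.4, Thm. 4.6, Cor. 4.7, Thm. 4.11;
Constantin–Foias 1988, Ch. 8; the faces are weakly closed and the enstrophy cap makes the data
converge strongly). -/
theorem GalerkinTrapToLerayHopf_proof :
    Summit.AnomalousDissipation.AnomalousDissipation.Theses.WazewskiBlock.GalerkinTrapToLerayHopf := by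
  intro ν m N₀ f E ε₀ G hν hf _hmean htrap
  -- the trapped trajectories of orders `n + N₀`
  have htrap' := fun n : ℕ => htrap (n + N₀) (Nat.le_add_left N₀ n)
  choose U hU using htrap'
  have hcont := fun n => (hU n).1.1
  have hslice := fun n => (hU n).1.2.1
  have hgal := fun n => (hU n).1.2.2.1
  have hen := fun n => (hU n).1.2.2.2
  have hbox := fun n => (hU n).2
  -- `E ≥ 0` (the block is nonempty)
  have hE : 0 ≤ E := (kineticEnergy_nonneg (U 0 0)).trans ((hbox 0) 0 le_rfl).1
  -- the steady force and the reference datum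
  set u₀ : UnitAddTorus (Fin 3) → EuclideanSpace ℝ (Fin 3) :=
    fun _ => EuclideanSpace.single (0 : Fin 3) (Real.sqrt (2 * E)) with hu₀def
  have hu₀ : MemLp u₀ 2 volume := memLp_const _
  have hu₀E : ∫ x, ‖u₀ x‖ ^ 2 = 2 * E := by
    rw [hu₀def, MomentParity.integral_norm_sq_const_single, Real.sq_sqrt (by positivity)]
  have hfm : AEStronglyMeasurable (stLift fun _ : ℝ => f) (volume.restrict (Ioi 0 ×ˢ univ)) :=
    MomentParity.aestronglyMeasurable_stLift_const hf.1 _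
  have hf₂ : ∀ T : ℝ, 0 < T → ∫⁻ _ in Ioo (0 : ℝ) T, ∫⁻ x, ‖f x‖ₑ ^ 2 < ⊤ := fun T _ =>
    MomentParity.lintegral_force_lt_top hf.1 T
  -- the trapped trajectories form a Hopf–Galerkin family
  have hS : IsHopfGalerkinFamily ν (fun _ => f) u₀ (fun n => n + N₀) (fun _ _ => f) U :=
    { tendsto_order := tendsto_add_atTop_nat N₀
      smooth_force := fun _ => MomentParity.contDiff_stLift_const hf.1
      tendsto_force := fun T _ => by
        simp only [sub_self, enorm_zero, ne_eq, OfNat.ofNat_ne_zero, not_false_eq_true, zero_pow,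
          lintegral_const, zero_mul]
        exact tendsto_const_nhds
      continuousOn := hcont
      isGalerkinMode := fun n t ht => (hslice n t ht).1
      isWeaklyDivFree := fun n t ht => (hslice n t ht).2
      galerkin := fun n a ha s t hs hst => hgal n a ha s t hs hst
      energy_eq := fun n s t hs hst => hen n s t hs hst
      initial_bound := fun n => by
        have h := ((hbox n) 0 le_rfl).1
        simp only [kineticEnergy] at h
        rw [hu₀E]
        linarith }
  -- the limit field along a subsequence
  obtain ⟨φ, hφ, u, hum, hu, hc⟩ := hS.exists_limitField hν.le hu₀ hfm hf₂
  have hS' := hS.comp_strictMono hφ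
  have hc' : ∀ t, 0 ≤ t → ∀ k, Tendsto
      (fun j => mFourierCoeff (EuclideanSpace.complexify ∘ (U ∘ φ) j t) k) atTop
      (𝓝 (mFourierCoeff (EuclideanSpace.complexify ∘ u t) k)) := hc
  -- enstrophy cap of the limit (Fatou), at every `t ≥ 0`
  have hgrad : ∀ t, 0 ≤ t → eGradNormSq (u t) ≤ (G : ℝ≥0∞) := fun t ht =>
    (eGradNormSq_le_liminf_of_tendsto_mFourierCoeff hc ht).trans
      (liminf_le_of_frequently_le'
        (Eventually.of_forall fun j => ((hbox (φ j)) t ht).2.2).frequently)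
  -- strong convergence of the data (Rellich via the enstrophy cap at `t = 0`)
  have h0 : Tendsto (fun j => eLpNorm ((U ∘ φ) j 0 - u 0) 2 volume) atTop (𝓝 0) :=
    tendsto_eLpNorm_sub_of_tendsto_mFourierCoeff_of_eGradNormSq_le (fun j => hS'.memLp_slice j le_rfl)
      (hu 0 le_rfl) (fun j => ((hbox (φ j)) 0 le_rfl).2.2) (hc' 0 le_rfl)
  -- the limit is a global Leray–Hopf solution from `u 0`
  have hLH : IsGlobalLerayHopf ν (fun _ => f) (u 0) u :=
    hS'.isGlobalLerayHopf_limit hν hu₀ hfm hf₂ hum hu hc' h0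
  refine ⟨u 0, u, hLH, fun t ht => ⟨?_, ?_, hgrad t ht⟩⟩
  · -- energy cap: Parseval and lower semicontinuity
    have hY : ∀ j, ∫ x, ‖(U ∘ φ) j t x‖ ^ 2 ≤ 2 * E := fun j => by
      have h := ((hbox (φ j)) t ht).1
      simp only [kineticEnergy] at h
      simp only [Function.comp_apply]
      linarith
    have h := integral_norm_sq_le_of_tendsto_mFourierCoeff (fun j => hS'.memLp_slice j ht) (hu t ht) hY
      (hc' t ht)
    simp only [kineticEnergy]
    linarith
  · -- work floor: weak `L²` convergence at time `t`
    have hw := hS'.tendsto_integral_inner_limit hν.le hu₀ hfm hf₂ hu hc' (hf.1.memLp 2) ht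
    have hcomm : ∀ v : UnitAddTorus (Fin 3) → EuclideanSpace ℝ (Fin 3),
        (∫ x, ⟪f x, v x⟫) = ∫ x, ⟪v x, f x⟫ := fun v =>
      integral_congr_ae (ae_of_all _ fun x => real_inner_comm _ _)
    rw [hcomm]
    refine ge_of_tendsto' hw fun j => ?_
    rw [← hcomm]
    exact ((hbox (φ j)) t ht).2.1

end Summit.AnomalousDissipation.AnomalousDissipation.Theorems
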